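import Summits.QuantumAdvantage.QuantumAdvantage.Theorems.CubicForrelationNearExactIsExactTenCensusWalsh
import Summits.QuantumAdvantage.QuantumAdvantage.Theorems.CubicForrelationNearExactIsExactNineDigits
import Summits.QuantumAdvantage.QuantumAdvantage.Theorems.CubicForrelationSignedExactSliceIsLiftStubMoebius

/-!
# Crux `CubicForrelation.NearExactIsExact` (stmt-QuantumAdvantage-14043): the `n = 10`, `θ = 7/8` census —
  the two tower cases for the partner's heavy restriction (part B of the discharge of CENSUS₁₀′)

Block-2b certificate seat `b2b-cforr-cert` (2026-08-18).  HONEST FRAMING: a THEOREM about the finite slice `n = 10`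
of the crux, NOT summit progress.

Let `F₀ = f₁(· ‖ bh)` be the restriction of the cubic partner to the heavy hyperplane (a cubic on 9 bits), `s = (−1)^{F₀}`,
and `e = p − s` the (even, integer) heavy error, with `Σ e² < 128` (heavy budget) and Fourier identity
`ê = 32·C − W_{F₀}` where `C ∈ {0, ±1}` has quadratic support (`nf10_W_p`).  By Ax, `W_{F₀} = 8u`; the level-3 parity of
`u` is constant (`stub_walshTower`), and:
* `nf10_caseE`: if `W_{F₀} = 16u₄` then `e ≡ 0`.  (Level-4 parity affine: if non-zero it holds on `≥ 256` points where
  `ê ≡ 16 (mod 32)`, contradicting `Σ ê² = 512 Σe² < 2¹⁶`; so `W_{F₀} = 32u₅` with `[u₅ odd]` CUBIC, `ê = 32ζ`, `|ζ| ≤ 1`,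
  `[ζ ≠ 0] = [C odd] ⊕ [u₅ odd]` cubic of weight `Σζ² = Σe²/2 < 64` — hence zero by the Reed–Muller bound.)
* `nf10_caseO`: if every `u` is odd then `e = −8η·δ_c` for a point `c` and a sign `η`.  (Digits `u = 1 + 2t + 4u₂`, `t`
  affine with sign character `η(−1)^{c·y}`, `[u₂ odd]` cubic — `nine_digit_two/three`; `e = 2e'`, `χ·ê' = 16k − 4` with
  `[k odd]` cubic, `Σk = 128 + 32q`, `q = ηe'(c)`, `Σ(16k−4)² = 512Σe'² ≤ 512·31`; the integer bookkeeping leaves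
  `q ∈ {−3, −4}`; `q = −3` puts `#{k odd}` in `[1, 46]`, `q = −4` forces `k ≡ 0`.)
Part C (`…TenIsolation78Final.lean`) turns both outcomes into contradictions with the energy identity
`Σp² = 4·#{Q = bh}` and lands `isolation_ten_78`.  Axioms: the standard three.
-/

set_option linter.dupNamespace false -- D-0017: single-problem summit ⇒ `QuantumAdvantage.QuantumAdvantage` by design

noncomputable section

namespace Summit.QuantumAdvantage.QuantumAdvantage.Theorems.CubicForrelation.NearExactIsExact

open Finset
open Literature.Computability.QuantumComplexity
open Literature.Computability.QuantumComplexity.BuzetChailloux (signOf_sq)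
open Literature.Computability.QuantumComplexity.DerivativeWalsh (W sum_W_sq)

/-! ### Small tools -/

/-- A degree-`0` Boolean function on 9 bits that is `true` somewhere is `true` everywhere (Reed–Muller weight bound). -/
theorem nf10_all_of_deg_zero {P : (Fin (4 + 4 + 1) → Bool) → Bool} (hP : IsDegLeFun 0 P) {y₀ : Fin (4 + 4 + 1) → Bool}
    (h0 : P y₀ = true) : ∀ y, P y = true := by
  have h := stub_rmWeight stub_derivDegree (4 + 4 + 1) 0 P hP ⟨y₀, h0⟩
  have hcard : #(univ.filter fun y : Fin (4 + 4 + 1) → Bool => P y = true) = Fintype.card (Fin (4 + 4 + 1) → Bool) := by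
    refine le_antisymm (card_le_univ _) ?_
    simpa [Fintype.card_fun, Fintype.card_bool, Fintype.card_fin] using h
  have huniv := Finset.eq_univ_of_card _ hcard
  intro y
  have hy : y ∈ univ.filter fun y : Fin (4 + 4 + 1) → Bool => P y = true := by rw [huniv]; exact mem_univ _
  exact (mem_filter.1 hy).2

/-- Reed–Muller weight bound on 9 bits, contrapositive: a degree-`≤ d` Boolean function with fewer than `2^{9−d}` ones is
identically `false`. -/
theorem nf10_all_false_of_card_lt {d : ℕ} {P : (Fin (4 + 4 + 1) → Bool) → Bool} (hP : IsDegLeFun d P)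
    (hlt : 2 ^ d * #(univ.filter fun y : Fin (4 + 4 + 1) → Bool => P y = true) < 2 ^ (4 + 4 + 1)) :
    ∀ y, P y = false := by
  intro y
  by_contra hy
  have h := stub_rmWeight stub_derivDegree (4 + 4 + 1) d P hP ⟨y, by simpa using hy⟩
  omega

/-- `[2a odd] = false`. [folklore] -/
theorem nf10_decide_odd_two_mul (a : ℤ) : decide (Odd (2 * a)) = false := by
  simp

/-- The counting measure of the odd points is dominated by the sum of squares. [folklore] -/
theorem nf10_card_odd_le_sum_sq (k : (Fin (4 + 4 + 1) → Bool) → ℤ) :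
    ((#(univ.filter fun y : Fin (4 + 4 + 1) → Bool => decide (Odd (k y)) = true) : ℕ) : ℤ) ≤ ∑ y, k y ^ 2 := by
  rw [Finset.natCast_card_filter]
  refine sum_le_sum fun y _ => ?_
  split_ifs with h
  · have hk : k y ≠ 0 := by
      intro h0
      rw [decide_eq_true_eq, h0] at h
      exact (by decide : ¬ Odd (0 : ℤ)) h
    nlinarith [sq_pos_of_ne_zero hk]
  · positivity

/-- An even integer with square `≤ 1` is `0`. [folklore] -/
theorem nf10_even_sq_le_one {z : ℤ} (hz : Even z) (h : z ^ 2 ≤ 1) : z = 0 := by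
  obtain ⟨m, rfl⟩ := hz
  rcases le_or_gt 1 m with h1 | h1
  · nlinarith
  rcases le_or_gt m (-1) with h2 | h2
  · nlinarith
  · omega

/-! ### Case E: the partner's heavy restriction has all Walsh values divisible by 16 -/

/-- **Case E.** See the file header. -/
theorem nf10_caseE (f₁ : (Fin (4 + 4 + 1 + 1) → Bool) → Bool) (bh : Bool) (hf₁ : IsDegLeFun 3 f₁)
    (e C u₄ : (Fin (4 + 4 + 1) → Bool) → ℤ)
    (hW : ∀ y, W (fun z => signOf (f₁ (Fin.snoc z bh))) y = (2 : ℝ) ^ 4 * (u₄ y : ℝ))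
    (he : ∀ y, W (fun z => (e z : ℝ)) y = 32 * (C y : ℝ) - W (fun z => signOf (f₁ (Fin.snoc z bh))) y)
    (hCdeg : IsDegLeFun 3 (fun y => decide (Odd (C y))))
    (hesq : ∑ z, ((e z : ℝ)) ^ 2 < 128) (heven : ∀ z, Even (e z)) : ∀ z, e z = 0 := by
  have hF₀ : IsDegLeFun 3 (fun z : Fin (4 + 4 + 1) → Bool => f₁ (Fin.snoc z bh)) := tb_isDegLeFun_snoc (F := f₁) hf₁ bh
  -- Parseval for `e` and the pointwise bound `|ê| ≤ Σ|e| ≤ Σe²/2 < 64`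
  have hPe : ∑ y, W (fun z => (e z : ℝ)) y ^ 2 = 512 * ∑ z, ((e z : ℝ)) ^ 2 := by
    rw [sum_W_sq]; norm_num
  have habs : ∀ y, |W (fun z => (e z : ℝ)) y| < 64 := by
    intro y
    have h1 := nf10_abs_W_le (fun z => (e z : ℝ)) y
    have h2 : ∑ z, |((e z : ℝ))| ≤ (∑ z, ((e z : ℝ)) ^ 2) / 2 := by
      rw [le_div_iff₀ (by norm_num : (0 : ℝ) < 2), sum_mul]
      refine sum_le_sum fun z _ => ?_
      have := nf10_two_abs_le_sq (e z) (heven z)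
      have h' : ((2 * |e z| : ℤ) : ℝ) ≤ ((e z ^ 2 : ℤ) : ℝ) := by exact_mod_cast this
      push_cast at h'
      linarith
    linarith
  -- level-4 parity is affine
  have hdeg1 : IsDegLeFun 1 (fun y => decide (Odd (u₄ y))) :=
    stub_walshTower stub_axParity (4 + 4 + 1) 4 1 _ u₄ hF₀ hW (fun k hk hk9 => by omega)
  -- all `u₄` are even
  have hE4 : ∀ y, decide (Odd (u₄ y)) = false := by
    by_contra hne
    push Not at hne
    obtain ⟨y₀, hy₀⟩ := hne
    have hy₀' : decide (Odd (u₄ y₀)) = true := by simpa using hy₀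
    have hcnt := stub_rmWeight stub_derivDegree (4 + 4 + 1) 1 _ hdeg1 ⟨y₀, hy₀'⟩
    -- on odd points, `ê² ≥ 256`
    have hpt : ∀ y, (if decide (Odd (u₄ y)) = true then (256 : ℝ) else 0) ≤ W (fun z => (e z : ℝ)) y ^ 2 := by
      intro y
      split_ifs with h
      · rw [decide_eq_true_eq] at h
        rw [he y, hW y]
        obtain ⟨m, hm⟩ := h
        have hne : (2 * C y - u₄ y : ℤ) ≠ 0 := by omega
        have h1 : (1 : ℤ) ≤ (2 * C y - u₄ y) ^ 2 := by
          have := sq_pos_of_ne_zero hne; omega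
        have h1' : (1 : ℝ) ≤ ((2 * C y - u₄ y : ℤ) : ℝ) ^ 2 := by exact_mod_cast h1
        push_cast at h1'
        nlinarith [h1']
      · positivity
    have hsum := sum_le_sum fun y (_ : y ∈ (univ : Finset (Fin (4 + 4 + 1) → Bool))) => hpt y
    rw [← sum_filter, sum_const, nsmul_eq_mul, hPe] at hsum
    have hc : (256 : ℝ) ≤ (#(univ.filter fun y : Fin (4 + 4 + 1) → Bool => decide (Odd (u₄ y)) = true) : ℝ) := by
      have : 256 ≤ #(univ.filter fun y : Fin (4 + 4 + 1) → Bool => decide (Odd (u₄ y)) = true) := by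
        simp only [show (2 : ℕ) ^ (4 + 4 + 1) = 512 by norm_num, show (2 : ℕ) ^ 1 = 2 by norm_num] at hcnt
        omega
      exact_mod_cast this
    nlinarith
  -- so `W_{F₀} = 32 u₅`
  have hE4' : ∀ y, ∃ m : ℤ, u₄ y = 2 * m := fun y => by
    have h := hE4 y
    rw [decide_eq_false_iff_not, Int.not_odd_iff_even] at h
    obtain ⟨m, hm⟩ := h
    exact ⟨m, by omega⟩
  choose u₅ hu₅ using hE4'
  have hW5 : ∀ y, W (fun z => signOf (f₁ (Fin.snoc z bh))) y = (2 : ℝ) ^ 5 * (u₅ y : ℝ) := fun y => by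
    rw [hW y, hu₅ y]; push_cast; ring
  have hdeg3 : IsDegLeFun 3 (fun y => decide (Odd (u₅ y))) :=
    stub_walshTower stub_axParity (4 + 4 + 1) 5 3 _ u₅ hF₀ hW5 (fun k hk hk9 => by omega)
  -- `ê = 32 ζ`, `ζ = C − u₅ ∈ {−1,0,1}`
  have hζ : ∀ y, W (fun z => (e z : ℝ)) y = 32 * ((C y - u₅ y : ℤ) : ℝ) := fun y => by
    rw [he y, hW5 y]; push_cast; ring
  have hζ1 : ∀ y, (C y - u₅ y) ^ 2 ≤ 1 := by
    intro y
    have h := habs y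
    rw [hζ y, abs_mul, abs_of_pos (by norm_num : (0 : ℝ) < 32)] at h
    have h' : |((C y - u₅ y : ℤ) : ℝ)| < 2 := by linarith
    have h'' : |C y - u₅ y| < 2 := by exact_mod_cast h'
    rw [abs_lt] at h''
    nlinarith [h''.1, h''.2]
  -- `[ζ ≠ 0] = [C odd] ⊕ [u₅ odd]` has degree ≤ 3
  have hB : IsDegLeFun 3 (fun y => decide (C y - u₅ y ≠ 0)) := by
    refine rm_isDegLeFun_congr
      (SignedExactSliceIsLift.StubMoebius.isDegLeFun_xor hCdeg hdeg3) fun y => ?_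
    have h1 := hζ1 y
    rcases Int.even_or_odd (C y) with hc | hc <;> rcases Int.even_or_odd (u₅ y) with hu | hu
    · have : Even (C y - u₅ y) := hc.sub hu
      have h0 : C y - u₅ y = 0 := nf10_even_sq_le_one this h1
      simp [Int.not_odd_iff_even.2 hc, Int.not_odd_iff_even.2 hu, h0]
    · have : Odd (C y - u₅ y) := hc.sub_odd hu
      have h0 : C y - u₅ y ≠ 0 := fun h => by rw [h] at this; exact (by decide : ¬ Odd (0 : ℤ)) this
      simp [Int.not_odd_iff_even.2 hc, hu, h0]
    · have : Odd (C y - u₅ y) := hc.sub_even hu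
      have h0 : C y - u₅ y ≠ 0 := fun h => by rw [h] at this; exact (by decide : ¬ Odd (0 : ℤ)) this
      simp [hc, Int.not_odd_iff_even.2 hu, h0]
    · have : Even (C y - u₅ y) := hc.sub_odd hu
      have h0 : C y - u₅ y = 0 := nf10_even_sq_le_one this h1
      simp [hc, hu, h0]
  -- its weight is `Σ ζ² = Σ e²/2 < 64`
  have hcardR : ((#(univ.filter fun y : Fin (4 + 4 + 1) → Bool => decide (C y - u₅ y ≠ 0) = true) : ℕ) : ℝ) < 64 := by
    have hpt : ∀ y, (if decide (C y - u₅ y ≠ 0) = true then (1024 : ℝ) else 0) ≤ W (fun z => (e z : ℝ)) y ^ 2 := by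
      intro y
      split_ifs with h
      · rw [decide_eq_true_eq] at h
        rw [hζ y]
        have h1 : (1 : ℤ) ≤ (C y - u₅ y) ^ 2 := by have := sq_pos_of_ne_zero h; omega
        have h1' : (1 : ℝ) ≤ ((C y - u₅ y : ℤ) : ℝ) ^ 2 := by exact_mod_cast h1
        nlinarith [h1']
      · positivity
    have hsum := sum_le_sum fun y (_ : y ∈ (univ : Finset (Fin (4 + 4 + 1) → Bool))) => hpt y
    rw [← sum_filter, sum_const, nsmul_eq_mul, hPe] at hsum
    nlinarith
  have hcard : #(univ.filter fun y : Fin (4 + 4 + 1) → Bool => decide (C y - u₅ y ≠ 0) = true) < 64 := by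
    exact_mod_cast hcardR
  have hzero := nf10_all_false_of_card_lt hB (by
    simp only [show (2 : ℕ) ^ (4 + 4 + 1) = 512 by norm_num, show (2 : ℕ) ^ 3 = 8 by norm_num]; omega)
  -- hence `ê ≡ 0`, `Σ e² = 0`, `e ≡ 0`
  have hW0 : ∀ y, W (fun z => (e z : ℝ)) y = 0 := fun y => by
    have h := hzero y
    rw [decide_eq_false_iff_not, not_not] at h
    rw [hζ y, h]; simp
  have hs0 : ∑ z, ((e z : ℝ)) ^ 2 = 0 := by
    have h : ∑ y, W (fun z => (e z : ℝ)) y ^ 2 = 0 := sum_eq_zero fun y _ => by rw [hW0 y]; ring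
    rw [hPe] at h; linarith
  intro z
  have h := (sum_eq_zero_iff_of_nonneg fun z _ => sq_nonneg ((e z : ℝ))).1 hs0 z (mem_univ _)
  exact_mod_cast pow_eq_zero_iff (n := 2) (by norm_num) |>.1 h

/-! ### Case O: the partner's heavy restriction is type O (all Walsh values `8·odd`) -/

/-- Sum over `𝔽₂⁹` split at a point. [folklore] -/
theorem nf10_sum_split {M : Type*} [AddCommMonoid M] (φ : (Fin (4 + 4 + 1) → Bool) → M) (c : Fin (4 + 4 + 1) → Bool) :
    ∑ z, φ z = φ c + ∑ z ∈ univ.erase c, φ z := by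
  rw [add_sum_erase _ _ (mem_univ c)]

/-- **Case O.** See the file header: if every `W_{F₀}(y)/8` is odd then the heavy error is `e = −8η·δ_c`. -/
theorem nf10_caseO (f₁ : (Fin (4 + 4 + 1 + 1) → Bool) → Bool) (bh : Bool) (hf₁ : IsDegLeFun 3 f₁)
    (e C uF : (Fin (4 + 4 + 1) → Bool) → ℤ)
    (hW : ∀ y, W (fun z => signOf (f₁ (Fin.snoc z bh))) y = (2 : ℝ) ^ 3 * (uF y : ℝ)) (hodd : ∀ y, Odd (uF y))
    (he : ∀ y, W (fun z => (e z : ℝ)) y = 32 * (C y : ℝ) - W (fun z => signOf (f₁ (Fin.snoc z bh))) y)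
    (hCdeg : IsDegLeFun 3 (fun y => decide (Odd (C y))))
    (hesq : ∑ z, ((e z : ℝ)) ^ 2 < 128) (heven : ∀ z, Even (e z)) :
    ∃ (c : Fin (4 + 4 + 1) → Bool) (η : ℤ), (η = 1 ∨ η = -1) ∧ e c = -8 * η ∧ ∀ z, z ≠ c → e z = 0 := by
  have hF₀ : IsDegLeFun 3 (fun z : Fin (4 + 4 + 1) → Bool => f₁ (Fin.snoc z bh)) := tb_isDegLeFun_snoc (F := f₁) hf₁ bh
  -- digits of `uF = 1 + 2t + 4u₂`
  have h1' : ∀ y, ∃ m : ℤ, uF y = 2 * m + 1 := fun y => by obtain ⟨m, hm⟩ := hodd y; exact ⟨m, by omega⟩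
  choose u₁ hu₁ using h1'
  set t : (Fin (4 + 4 + 1) → Bool) → ℤ := fun y => if Odd (u₁ y) then 1 else 0 with ht
  have h2' : ∀ y, ∃ m : ℤ, u₁ y = 2 * m + t y := fun y => by
    by_cases h : Odd (u₁ y)
    · obtain ⟨m, hm⟩ := h; exact ⟨m, by simp [ht, hm]⟩
    · obtain ⟨m, hm⟩ := Int.not_odd_iff_even.1 h; exact ⟨m, by simp [ht, h]; omega⟩
  choose u₂ hu₂ using h2'
  have hdegt : IsDegLeFun 1 (fun y => decide (Odd (u₁ y))) := nine_digit_two _ uF hF₀ hW u₁ hu₁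
  have hdeg3 : IsDegLeFun 3 (fun y => decide (Odd (u₂ y))) := nine_digit_three _ uF hF₀ hW u₁ u₂ t hu₁ hu₂ (fun y => rfl)
  obtain ⟨c, b₀, hχ⟩ := stub_affineForm (4 + 4 + 1) (fun y => decide (Odd (u₁ y))) hdegt
  set η : ℤ := if b₀ then -1 else 1 with hη
  have hηR : (η : ℝ) = signOf b₀ := by cases b₀ <;> simp [hη, signOf]
  have hη1 : η = 1 ∨ η = -1 := by cases b₀ <;> simp [hη]
  -- `e = 2 e'`
  have he2 : ∀ z, ∃ m : ℤ, e z = 2 * m := fun z => by obtain ⟨m, hm⟩ := heven z; exact ⟨m, by omega⟩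
  choose e' he' using he2
  have hWe' : ∀ y, W (fun z => (e z : ℝ)) y = 2 * W (fun z => (e' z : ℝ)) y := fun y => by
    unfold W; rw [mul_sum]; exact sum_congr rfl fun z _ => by simp only [he' z]; push_cast; ring
  have hesq' : ∑ z, e' z ^ 2 ≤ 31 := by
    have h : ∑ z, ((e z : ℝ)) ^ 2 = 4 * ∑ z, ((e' z : ℝ)) ^ 2 := by
      rw [mul_sum]; exact sum_congr rfl fun z _ => by rw [he' z]; push_cast; ring
    have h2 : ∑ z, ((e' z : ℝ)) ^ 2 < 32 := by linarith
    have h3 : ((∑ z, e' z ^ 2 : ℤ) : ℝ) < 32 := by push_cast; exact h2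
    have h4 : (∑ z, e' z ^ 2 : ℤ) < 32 := by exact_mod_cast h3
    omega
  -- `k` and the identity `χ · ê' = 16 k − 4`
  set k : (Fin (4 + 4 + 1) → Bool) → ℤ :=
    fun y => (C y + -u₂ y) + t y + -(2 * (t y * (C y + -u₂ y))) with hk
  have ht01 : ∀ y, t y = 0 ∨ t y = 1 := fun y => by by_cases h : Odd (u₁ y) <;> simp [ht, h]
  have hχt : ∀ y, signOf (decide (Odd (u₁ y))) = 1 - 2 * (t y : ℝ) := fun y => by
    by_cases h : Odd (u₁ y)
    · simp [ht, h, signOf]; norm_num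
    · simp [ht, h, signOf]
  have hkey : ∀ y, signOf b₀ * twist c y * W (fun z => (e' z : ℝ)) y = 16 * (k y : ℝ) - 4 := by
    intro y
    have h1 : W (fun z => (e' z : ℝ)) y = 16 * (C y : ℝ) - 4 - 8 * (t y : ℝ) - 16 * (u₂ y : ℝ) := by
      have := he y
      rw [hWe', hW y, hu₁ y, hu₂ y] at this
      push_cast at this
      linarith
    rw [← hχ y, hχt y, h1, hk]
    push_cast
    rcases ht01 y with h0 | h0 <;> simp only [h0] <;> push_cast <;> ring
  -- parity of `k` is a cubic Boolean function
  have hdt : ∀ y, decide (Odd (t y)) = decide (Odd (u₁ y)) := fun y => by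
    by_cases h : Odd (u₁ y) <;> simp [ht, h]
  have hκ : IsDegLeFun 3 (fun y => decide (Odd (k y))) := by
    refine rm_isDegLeFun_congr
      (SignedExactSliceIsLift.StubMoebius.isDegLeFun_xor
        (SignedExactSliceIsLift.StubMoebius.isDegLeFun_xor hCdeg hdeg3) (hdegt.mono (by norm_num))) fun y => ?_
    simp only [hk, nf10_decide_odd_add, nf10_decide_odd_neg, nf10_decide_odd_two_mul, hdt, Bool.xor_false]
  -- the two sums
  have hS1 : ∑ y, (16 * (k y : ℝ) - 4) = 512 * (η : ℝ) * (e' c : ℝ) := by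
    rw [← sum_congr rfl fun y _ => hkey y]
    have : ∑ y, signOf b₀ * twist c y * W (fun z => (e' z : ℝ)) y =
        signOf b₀ * ∑ y, twist c y * W (fun z => (e' z : ℝ)) y := by
      rw [mul_sum]; exact sum_congr rfl fun y _ => by ring
    rw [this, nf10_sum_twist_mul_W, hηR]; norm_num; ring
  have hS2 : ∑ y, (16 * (k y : ℝ) - 4) ^ 2 = 512 * ∑ z, ((e' z : ℝ)) ^ 2 := by
    have : ∀ y, (16 * (k y : ℝ) - 4) ^ 2 = W (fun z => (e' z : ℝ)) y ^ 2 := fun y => by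
      rw [← hkey y, mul_pow, mul_pow, signOf_sq, Literature.Computability.QuantumComplexity.Simon.twist_sq]; ring
    rw [sum_congr rfl fun y _ => this y, sum_W_sq]; norm_num
  -- integer bookkeeping
  set A : ℤ := ∑ y, k y with hA
  set B : ℤ := ∑ y, k y ^ 2 with hB
  have hAq : A = 128 + 32 * (η * e' c) := by
    have h : ((∑ y, (16 * k y - 4) : ℤ) : ℝ) = ((512 * η * e' c : ℤ) : ℝ) := by push_cast; rw [← hS1]
    have h' : (∑ y, (16 * k y - 4) : ℤ) = 512 * η * e' c := by exact_mod_cast h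
    rw [sum_sub_distrib, ← mul_sum, sum_const, card_univ] at h'
    simp only [Fintype.card_fun, Fintype.card_bool, Fintype.card_fin] at h'
    norm_num at h'
    rw [hA]; linarith
  have hBq : 256 * B - 128 * A + 8192 = 512 * ∑ z, e' z ^ 2 := by
    have h : ((∑ y, (16 * k y - 4) ^ 2 : ℤ) : ℝ) = ((512 * ∑ z, e' z ^ 2 : ℤ) : ℝ) := by push_cast; rw [← hS2]
    have h' : (∑ y, (16 * k y - 4) ^ 2 : ℤ) = 512 * ∑ z, e' z ^ 2 := by exact_mod_cast h
    have hexp : ∑ y, (16 * k y - 4) ^ 2 = 256 * B - 128 * A + ∑ y : Fin (4 + 4 + 1) → Bool, (16 : ℤ) := by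
      rw [hA, hB, mul_sum, mul_sum, ← sum_sub_distrib, ← sum_add_distrib]
      exact sum_congr rfl fun y _ => by ring
    rw [hexp, sum_const, card_univ] at h'
    simp only [Fintype.card_fun, Fintype.card_bool, Fintype.card_fin] at h'
    norm_num at h'
    linarith
  have hBA : A ≤ B ∧ -A ≤ B := by
    rw [hA, hB, ← sum_neg_distrib]
    exact ⟨sum_le_sum fun y _ => (nf10_le_sq (k y)).1, sum_le_sum fun y _ => (nf10_le_sq (k y)).2⟩
  have hec : (e' c) ^ 2 ≤ 31 := by
    have h := hesq'
    rw [nf10_sum_split _ c] at h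
    have : 0 ≤ ∑ z ∈ univ.erase c, e' z ^ 2 := sum_nonneg fun z _ => sq_nonneg _
    linarith
  set q : ℤ := η * e' c with hq
  have hq2 : q ^ 2 ≤ 31 := by rcases hη1 with h | h <;> simp [hq, h, hec]
  have hq5 : -5 ≤ q ∧ q ≤ 5 := by constructor <;> nlinarith [hq2]
  have hq34 : q = -3 ∨ q = -4 := by omega
  -- the number of odd `k` is at most `B`
  have hoddB := nf10_card_odd_le_sum_sq k
  rw [← hB] at hoddB
  rcases hq34 with hq3 | hq4
  · -- q = −3: `A = 32`, `B ≤ 46`, some `k` is odd, but a non-zero cubic has ≥ 64 ones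
    exfalso
    have hA32 : A = 32 := by rw [hAq, hq3]; norm_num
    have hB46 : B ≤ 46 := by omega
    have hex : ∃ y, decide (Odd (k y)) = true := by
      by_contra hno
      push Not at hno
      have h2 : 2 * A ≤ B := by
        rw [hA, hB, mul_sum]
        refine sum_le_sum fun y _ => ?_
        have hy : ¬ Odd (k y) := by simpa using hno y
        obtain ⟨m, hm⟩ := Int.not_odd_iff_even.1 hy
        rcases le_or_gt m 0 with hm0 | hm1 <;> nlinarith [hm]
      omega
    have h64 := stub_rmWeight stub_derivDegree (4 + 4 + 1) 3 _ hκ hex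
    simp only [show (2 : ℕ) ^ (4 + 4 + 1) = 512 by norm_num, show (2 : ℕ) ^ 3 = 8 by norm_num] at h64
    omega
  · -- q = −4: `A = 0`, `B ≤ 30`, all `k` even, then all `k = 0`, so `e' = −4η δ_c`
    have hA0 : A = 0 := by rw [hAq, hq4]; norm_num
    have hB30 : B ≤ 30 := by omega
    have hkeven : ∀ y, decide (Odd (k y)) = false :=
      nf10_all_false_of_card_lt hκ (by
        simp only [show (2 : ℕ) ^ (4 + 4 + 1) = 512 by norm_num, show (2 : ℕ) ^ 3 = 8 by norm_num]; omega)
    -- `Σ|e'| ≤ 19`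
    have hec4 : e' c = -4 * η := by
      rcases hη1 with h | h
      · rw [h]; rw [hq, h] at hq4; linarith
      · rw [h]; rw [hq, h] at hq4; linarith
    have hrest : ∑ z ∈ univ.erase c, e' z ^ 2 = ∑ z, e' z ^ 2 - 16 := by
      rw [nf10_sum_split _ c, hec4]; rcases hη1 with h | h <;> simp [h]
    have hsumE : ∑ z, e' z ^ 2 = B / 2 + 16 := by omega
    have habs' : ∑ z, |e' z| ≤ 19 := by
      rw [nf10_sum_split _ c]
      have h1 : |e' c| = 4 := by rw [hec4]; rcases hη1 with h | h <;> simp [h]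
      have h2 : ∑ z ∈ univ.erase c, |e' z| ≤ ∑ z ∈ univ.erase c, e' z ^ 2 :=
        sum_le_sum fun z _ => by rcases le_or_gt 0 (e' z) with h | h
                                 · rw [abs_of_nonneg h]; nlinarith [(nf10_le_sq (e' z)).1]
                                 · rw [abs_of_neg h]; nlinarith [(nf10_le_sq (e' z)).2]
      omega
    have hk0 : ∀ y, k y = 0 := by
      intro y
      have h1 : |W (fun z => (e' z : ℝ)) y| ≤ 19 := by
        refine (nf10_abs_W_le _ y).trans ?_
        have : ((∑ z, |e' z| : ℤ) : ℝ) ≤ 19 := by exact_mod_cast habs'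
        push_cast at this
        exact this
      have h2 : |16 * (k y : ℝ) - 4| ≤ 19 := by
        rw [← hkey y, abs_mul, abs_mul, abs_signOf, abs_twist, one_mul, one_mul]; exact h1
      rw [abs_le] at h2
      have h3 : (16 * k y - 4 : ℤ) ≤ 19 := by
        have : ((16 * k y - 4 : ℤ) : ℝ) ≤ 19 := by push_cast; exact h2.2
        exact_mod_cast this
      have h4 : (-19 : ℤ) ≤ 16 * k y - 4 := by
        have : (-19 : ℝ) ≤ ((16 * k y - 4 : ℤ) : ℝ) := by push_cast; exact h2.1
        exact_mod_cast this
      have h5 : ¬ Odd (k y) := by simpa using hkeven y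
      obtain ⟨m, hm⟩ := Int.not_odd_iff_even.1 h5
      omega
    have hB0 : B = 0 := by rw [hB]; exact sum_eq_zero fun y _ => by rw [hk0 y]; ring
    have hrest0 : ∀ z, z ≠ c → e' z = 0 := by
      intro z hz
      have hsum0 : ∑ z ∈ univ.erase c, e' z ^ 2 = 0 := by rw [hrest, hsumE, hB0]; norm_num
      have h := (sum_eq_zero_iff_of_nonneg fun z _ => sq_nonneg (e' z)).1 hsum0 z (mem_erase.2 ⟨hz, mem_univ _⟩)
      exact pow_eq_zero_iff (n := 2) (by norm_num) |>.1 h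
    refine ⟨c, η, hη1, ?_, fun z hz => ?_⟩
    · rw [he' c, hec4]; ring
    · rw [he' z, hrest0 z hz]; ring

end Summit.QuantumAdvantage.QuantumAdvantage.Theorems.CubicForrelation.NearExactIsExact
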